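/-
Copyright (c) 2026 the pub-hodgecm-mathlib formalisation cell (harness21).  Prover seat hodgecm-mathlib-K2E1-p16 (g4), Track B ∕ K2-LIT, h413 = `stmt-HodgeConjecture-24833`,
R90-TF section S8 «ContSpec-n½», ESTATE T ∕ (R)′ row `hEXP`, S8 dealer R90-CS-plan (g3) S8-R231 (1) = RULING J-S8-CO STEP (3) «THE PRODUCT REALISATION of
`K_∞ := ↥archMaximalCompact`», FILE B of two (400-line law): ★ (α) `R90S8KTypeSliceLineU3` READ AT THE ARCHIMEDEAN MAXIMAL COMPACT OF RECORD — the generic PRODUCT Gelfand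
pair (jointly injective family of unitary `J₃`-commuting realisations, torus `diag(u_i, β_i, u_i)` with product surjectivity, transpose as an anti-homomorphism fixing the torus, `hconj`
for the PRODUCT) and the Gelfand-pair theorems ONCE for `(G, K) := (K_∞, M_∞ = K_∞ ∩ B(𝔸))`, the place-wise inputs being FILE A `R90S8ArchMaximalCompactPlacewiseU3`.
-/
import Summits.HodgeConjecture.HodgeConjecture.Theorems.R90S8ArchMaximalCompactPlacewiseU3        -- ★ FILE A (this seat): place-wise `K_∞`, torus shape, product surjectivity, transpose partner, compactness
import Summits.HodgeConjecture.HodgeConjecture.Theorems.R90S8KTypeSliceLineU3                   -- ★ (α) (K2E1-p14): §1 `exists_torus_mul_eq_transpose_mul`; brings ★ `commute_orbitalOp_of_antiHom`, `exists_forall_homSpace_eq_smul_of_commute_orbitalOp`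
import Literature.NumberTheory.Automorphic.UnitaryGroupOfFormAdelicTopology                       -- ★ instance `secondCountableTopology_adelic` on `U(J)(𝔸)`
import Literature.MeasureTheory.Group.HaarLocalChart                                              -- ★ compact groups: `isMulRightInvariant_of_isHaarMeasure`, `isInvInvariant_of_isHaarMeasure`
import HarnessLib

/-!
# R90-TF · S8 «ContSpec-n½» — `R90S8ArchMaximalCompactTransposeRealisationU3`: GELFAND'S TRICK ON THE PRODUCT `K_∞ = ↥(archMaximalCompact L)` — TRANSPOSE-CONJUGACY BY THE TORUS
# `M_∞ = K_∞ ⊓ B(𝔸)` AND THE MULTIPLICITY-≤-1 LINE `Hom_{M_∞}(τ, π|_{M_∞})` FOR EVERY `K_∞`-TYPE `π` (J-S8-CO STEP (3), FILE B = HEADS)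

Cell `hodgecm-mathlib`, crux H413 (`stmt-HodgeConjecture-24833`, lane `--supports … --as helper`), route of record `HCCMUnconditional`; R90-TF section S8, ESTATE T, RULING J-S8-CO
(S8-R231): K2E1-p12 (g6)'s letter `hCO` («the co-weight functionals on an irreducible `K_∞`-type form a LINE») is reached in four steps (2) Riesz bridge · **(3) FILE A + this file** · (4)
Hilbert packaging · (5) assembly.  THEOREMS ONLY (no `def`, no `instance`, no `notation`, no named-fact hypothesis, no `sorry`; default heartbeats); count-neutral; CLOSES NO SOCKET.

THE MATHEMATICS ([Helgason2000] Ch. IV §3 Thm. 3.1 — Gelfand's trick; [Knapp1986] VIII §3; [DeitmarEchterhoff2014] Lemma 7.3.1; [BorelJacquet1979] §4.1; [Rogawski1990] §12.3).  ★ (α) proved, for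
ONE abstract compact group `K_v` realised injectively in `U(3)` with image commuting with `J₃ = antidiag(1,1,1)` and a torus `M_v ↠ {diag(u, β, u)}`, that the `M_v`-orbital operators of
every unitary `K_v`-representation commute (Gelfand's trick with `σ :=` transpose) and hence `Hom_{M_v}(τ, π|_{M_v})` is a LINE.  The archimedean group of record is the PRODUCT
`K_∞ = ι(U(J₃)(L ⊗ ℝ) ∩ K)` over the complex places `w` of `L` (FILE A), so NO single injective `K_∞ →* U(3)` exists; the family `j_w(k) := (k_∞)_w` is JOINTLY injective, and Gelfand's
trick runs on the product directly (no tensor decomposition of `K_∞`-types is needed):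
* §1 GENERIC PRODUCT GELFAND PAIR (hypothesis-first over an index type `I`, an unbundled multiplicative family `j : I → Kv → M₃(ℂ)` — unitary, `J₃`-commuting, jointly injective —, a
  torus `ι : Mv →* Kv` read as `diag(u_i, β_i, u_i)` with PRODUCT surjectivity `hjM`, and `σ` with `j_i (σ k) = (j_i k)ᵀ`): `antiHom_of_transpose_realisation_pi`, `transpose_apply_torus_eq_pi`,
  **`exists_torus_conj_eq_transpose_pi`** (`hconj`: ★ (α) §1 index by index, glued by `hjM` and joint injectivity), `torus_mul_comm_pi` (the torus is commutative — diagonal matrices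
  commute — so no `CommGroup` structure on a subgroup type is needed; `θ :=` inversion is built by hand), **`commute_orbitalOp_torus_of_transpose_realisation_pi`**,
  **`exists_forall_homSpace_torus_eq_smul_of_transpose_realisation_pi`**.
* §2 HEADS at `(G, K) := (K_∞, M_∞)`, `K_∞ := ↥(archMaximalCompact L)`, `M_∞ := ↥(archMaximalCompact L ⊓ borelAdelic L⁺ L c 3)`, `ι := Subgroup.inclusion inf_le_left`, `j_w(k) := (k_∞)_w`
  and `σ` the transpose partner of FILE A: **`commute_orbitalOp_archTorus`** (any two-sided, inversion-invariant probability measure on `M_∞`, under the caller's `[MeasurableSpace]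
  [BorelSpace] [CompactSpace]` on `M_∞`) and the μ-FREE, `MeasurableSpace`-FREE LINE **`exists_forall_homSpace_archTorus_eq_smul`**: for `π` an irreducible unitary strongly continuous
  representation of `K_∞` on a Hilbert space and `τ` a finite-dimensional irreducible unitary representation of `M_∞` (every unitary character, e.g. `m ↦ χ₁(m₀₀)χ₂(m₁₁)`),
  `∃ S₀ : Hom_{M_∞}(τ, π|_{M_∞}), ∀ S, ∃ c, S = c • S₀` (inside: `M_∞` compact by FILE A, `borelize`d, with the probability Haar measure `haarMeasure ⊤`, two-sided and inversion
  invariant by ★ `HaarLocalChart`).  Consumer: K2E1-p12 (g6) steps (2)(4)(5) (`hCO_of_transposeRealisations`).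
HONEST LABEL: HC_CM is proved only modulo the 7 printed citations (2 remaining named inputs: hLiu418 = `stmt-HodgeConjecture-24832`, h413 = `stmt-HodgeConjecture-24833`) until rung 0
closes; REL ≠ ★ ≠ BUILT; this file asserts no named fact and closes no socket; `hCO` itself is NOT claimed here (steps (2)(4)(5) remain); count-neutral; unconditional.

## References
* [Helgason2000] S. Helgason, *Groups and Geometric Analysis* (AMS 2000), Ch. IV §3, Thm. 3.1 (Gelfand's trick with an anti-automorphism).
* [Knapp1986] A. W. Knapp, *Representation Theory of Semisimple Groups* (1986), VIII §3 (K-types; Frobenius reciprocity).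
* [DeitmarEchterhoff2014] A. Deitmar, S. Echterhoff, *Principles of Harmonic Analysis* (2nd ed., 2014), §7.3, Lemma 7.3.1.
* [BorelJacquet1979] A. Borel, H. Jacquet, *Automorphic forms and automorphic representations*, Proc. Symp. Pure Math. 33.1 (1979), §1.1, §4.1 (`G_∞ = ∏_{w∣∞} G(L_w)`, `K = K_∞·G(𝒪̂)`).
* [Rogawski1990] J. D. Rogawski, *Automorphic Representations of Unitary Groups in Three Variables* (1990), §12.3 (K-types of `U(2,1)(ℝ)`).
-/

set_option autoImplicit false
set_option linter.dupNamespace false  -- the mandated namespace `…HodgeConjecture.HodgeConjecture.R90.S8` (LEAD #1 L1) repeats the summit's segment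

noncomputable section

open Matrix MeasureTheory MeasureTheory.Measure ContRepresentation NumberField NumberField.InfinitePlace Topology
open Literature.RepresentationTheory.CompactGroups
open Literature.NumberTheory.Automorphic Literature.NumberTheory.Automorphic.UnitaryGroup Literature.NumberTheory.GaloisRepresentations AdelicGroupData
open scoped ComplexConjugate InnerProductSpace

namespace Summit.HodgeConjecture.HodgeConjecture.R90.S8

/-! ## §1 The generic PRODUCT Gelfand pair: a jointly injective family of unitary `J₃`-commuting realisations `j_i : Kv → M₃(ℂ)` and a torus read as `diag(u_i, β_i, u_i)` -/

section GelfandPairPi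

variable {Kv : Type*} [Group Kv] {Mv : Type*} [Group Mv] {I : Type*}

/-- A map `σ` on `Kv` which is TRANSPOSITION in every member of a jointly injective multiplicative family `j_i : Kv → M₃(ℂ)` is an anti-homomorphism: `σ(ab) = σ(b)σ(a)`
(`(AB)ᵀ = BᵀAᵀ` index by index). [cite: Helgason2000, Ch. IV §3 Thm. 3.1] -/
theorem antiHom_of_transpose_realisation_pi (j : I → Kv → Matrix (Fin 3) (Fin 3) ℂ) (hjmul : ∀ i a b, j i (a * b) = j i a * j i b)
    (hj : ∀ a b : Kv, (∀ i, j i a = j i b) → a = b) {σ : Kv → Kv} (hσj : ∀ a i, j i (σ a) = (j i a)ᵀ) (a b : Kv) : σ (a * b) = σ b * σ a :=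
  hj _ _ fun i => by rw [hσj, hjmul, hjmul, Matrix.transpose_mul, hσj, hσj]

/-- The transpose FIXES the torus: `σ (ι m) = ι m`, since every `j_i (ι m) = diag(u, β, u)` is symmetric. [cite: Helgason2000, Ch. IV §3 Thm. 3.1] -/
theorem transpose_apply_torus_eq_pi (ι : Mv →* Kv) (j : I → Kv → Matrix (Fin 3) (Fin 3) ℂ) (hj : ∀ a b : Kv, (∀ i, j i a = j i b) → a = b) {σ : Kv → Kv}
    (hσj : ∀ a i, j i (σ a) = (j i a)ᵀ) (hjι : ∀ (m : Mv) (i : I), ∃ u β : ℂ, j i (ι m) = Matrix.diagonal ![u, β, u]) (m : Mv) : σ (ι m) = ι m :=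
  hj _ _ fun i => by
    obtain ⟨u, β, h⟩ := hjι m i
    rw [hσj, h, Matrix.diagonal_transpose]

/-- **`hconj` FOR THE PRODUCT**: every `z : Kv` satisfies `σ z = ι u · z · (ι u)⁻¹` for a torus element `u : Mv` — ★ (α) §1 `exists_torus_mul_eq_transpose_mul` at EACH `j_i z` gives
`(u_i, β_i)` with `(j_i z)ᵀ diag(u_i, β_i, u_i) = diag(u_i, β_i, u_i) (j_i z)`; the PRODUCT surjectivity `hjM` realises the whole family `(u_i, β_i)_i` by ONE `m : Mv`, and joint injectivity
glues. [cite: Helgason2000, Ch. IV §3 Thm. 3.1] [cite: Knapp1986, VIII §3] -/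
theorem exists_torus_conj_eq_transpose_pi (ι : Mv →* Kv) (j : I → Kv → Matrix (Fin 3) (Fin 3) ℂ) (hjmul : ∀ i a b, j i (a * b) = j i a * j i b)
    (hju : ∀ i a, j i a ∈ Matrix.unitaryGroup (Fin 3) ℂ) (hj : ∀ a b : Kv, (∀ i, j i a = j i b) → a = b)
    (hjJ : ∀ i a, j i a * !![(0 : ℂ), 0, 1; 0, 1, 0; 1, 0, 0] = !![(0 : ℂ), 0, 1; 0, 1, 0; 1, 0, 0] * j i a)
    (hjM : ∀ u β : I → ℂ, (∀ i, ‖u i‖ = 1) → (∀ i, ‖β i‖ = 1) → ∃ m : Mv, ∀ i, j i (ι m) = Matrix.diagonal ![u i, β i, u i])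
    {σ : Kv → Kv} (hσj : ∀ a i, j i (σ a) = (j i a)ᵀ) (z : Kv) : ∃ u : Mv, σ z = ι u * z * (ι u)⁻¹ := by
  choose u β hu hβ hcomm using fun i => exists_torus_mul_eq_transpose_mul (j i z) (hju i z) (hjJ i z)
  obtain ⟨m, hm⟩ := hjM u β hu hβ
  have h1 : σ z * ι m = ι m * z := hj _ _ fun i => by
    rw [hjmul, hjmul, hσj, hm]
    exact hcomm i
  exact ⟨m, eq_mul_inv_of_mul_eq h1⟩

/-- **The torus is commutative**: `j_i ∘ ι` lands in diagonal matrices, which commute, and `j` is jointly injective, `ι` injective. [cite: Knapp1986, VIII §3] -/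
theorem torus_mul_comm_pi (ι : Mv →* Kv) (hιi : Function.Injective ι) (j : I → Kv → Matrix (Fin 3) (Fin 3) ℂ) (hjmul : ∀ i a b, j i (a * b) = j i a * j i b)
    (hj : ∀ a b : Kv, (∀ i, j i a = j i b) → a = b) (hjι : ∀ (m : Mv) (i : I), ∃ u β : ℂ, j i (ι m) = Matrix.diagonal ![u, β, u]) (a b : Mv) : a * b = b * a :=
  hιi (hj _ _ fun i => by
    obtain ⟨u, β, ha⟩ := hjι a i
    obtain ⟨u', β', hb⟩ := hjι b i
    rw [map_mul, map_mul, hjmul, hjmul, ha, hb, Matrix.diagonal_mul_diagonal, Matrix.diagonal_mul_diagonal]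
    exact congrArg Matrix.diagonal (funext fun k => mul_comm _ _))

variable [TopologicalSpace Kv] [IsTopologicalGroup Kv]
variable [TopologicalSpace Mv] [IsTopologicalGroup Mv] [CompactSpace Mv] [MeasurableSpace Mv] [BorelSpace Mv] [SecondCountableTopology Mv]
variable {X : Type*} [NormedAddCommGroup X] [InnerProductSpace ℂ X] [CompleteSpace X]

/-- **THE ORBITAL OPERATORS OVER THE TORUS COMMUTE (product form)** — ★ `commute_orbitalOp_of_antiHom` READ WITH `(G, K) := (Kv, Mv)`: `σ :=` the transpose (an anti-homomorphism fixing the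
torus, §1), `θ :=` inversion on the (commutative, `torus_mul_comm_pi`) torus — Haar-preserving by inversion invariance and `σ(ι m) = ι m = (ι m⁻¹)⁻¹` —, `hconj :=`
`exists_torus_conj_eq_transpose_pi`. [cite: Helgason2000, Ch. IV §3 Thm. 3.1] [cite: DeitmarEchterhoff2014, Lemma 7.3.1] -/
theorem commute_orbitalOp_torus_of_transpose_realisation_pi (μ : Measure Mv) [IsProbabilityMeasure μ] [μ.IsMulLeftInvariant] [μ.IsMulRightInvariant] [μ.IsInvInvariant]
    (ι : Mv →* Kv) (hι : Continuous ι) (hιi : Function.Injective ι)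
    (j : I → Kv → Matrix (Fin 3) (Fin 3) ℂ) (hjmul : ∀ i a b, j i (a * b) = j i a * j i b) (hju : ∀ i a, j i a ∈ Matrix.unitaryGroup (Fin 3) ℂ)
    (hj : ∀ a b : Kv, (∀ i, j i a = j i b) → a = b) (hjJ : ∀ i a, j i a * !![(0 : ℂ), 0, 1; 0, 1, 0; 1, 0, 0] = !![(0 : ℂ), 0, 1; 0, 1, 0; 1, 0, 0] * j i a)
    (hjι : ∀ (m : Mv) (i : I), ∃ u β : ℂ, j i (ι m) = Matrix.diagonal ![u, β, u])
    (hjM : ∀ u β : I → ℂ, (∀ i, ‖u i‖ = 1) → (∀ i, ‖β i‖ = 1) → ∃ m : Mv, ∀ i, j i (ι m) = Matrix.diagonal ![u i, β i, u i])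
    (σ : Kv → Kv) (hσj : ∀ a i, j i (σ a) = (j i a)ᵀ)
    (π : ContRepresentation ℂ Kv X) (hπ : π.IsStronglyContinuous) (hU : π.IsUnitary) (x y : Kv) :
    Commute (orbitalOp μ ι π hι hπ hU x) (orbitalOp μ ι π hι hπ hU y) := by
  have hcomm := torus_mul_comm_pi ι hιi j hjmul hj hjι
  let θ : Mv ≃ₜ* Mv :=
    { toFun := fun m => m⁻¹
      invFun := fun m => m⁻¹
      left_inv := fun m => inv_inv m
      right_inv := fun m => inv_inv m
      map_mul' := fun a b => by rw [_root_.mul_inv_rev, hcomm]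
      continuous_toFun := continuous_inv
      continuous_invFun := continuous_inv }
  have hθ : MeasurePreserving θ μ μ := Measure.measurePreserving_inv μ
  have hσι : ∀ m : Mv, σ (ι m) = (ι (θ m))⁻¹ := fun m => by
    rw [transpose_apply_torus_eq_pi ι j hj hσj hjι m]
    show ι m = (ι m⁻¹)⁻¹
    rw [map_inv, inv_inv]
  exact commute_orbitalOp_of_antiHom (antiHom_of_transpose_realisation_pi j hjmul hj hσj) θ hθ hσι
    (exists_torus_conj_eq_transpose_pi ι j hjmul hju hj hjJ hjM hσj) x y

/-- **MULTIPLICITY ONE OF TORUS-TYPES IN `Kv`-TYPES (product form)** — ★ `exists_forall_homSpace_eq_smul_of_commute_orbitalOp` READ WITH `(G, K) := (Kv, Mv)`: for `π` an irreducible unitary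
strongly continuous representation of `Kv` and `τ` a finite-dimensional irreducible unitary representation of the torus, `Hom_{Mv}(τ, π|_{Mv})` is AT MOST A LINE. [cite: Helgason2000, Ch. IV §3 Thm. 3.1]
[cite: Knapp1986, VIII §3] [cite: DeitmarEchterhoff2014, Lemma 7.3.1] -/
theorem exists_forall_homSpace_torus_eq_smul_of_transpose_realisation_pi (μ : Measure Mv) [IsProbabilityMeasure μ] [μ.IsMulLeftInvariant] [μ.IsMulRightInvariant]
    [μ.IsInvInvariant] (ι : Mv →* Kv) (hι : Continuous ι) (hιi : Function.Injective ι)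
    (j : I → Kv → Matrix (Fin 3) (Fin 3) ℂ) (hjmul : ∀ i a b, j i (a * b) = j i a * j i b) (hju : ∀ i a, j i a ∈ Matrix.unitaryGroup (Fin 3) ℂ)
    (hj : ∀ a b : Kv, (∀ i, j i a = j i b) → a = b) (hjJ : ∀ i a, j i a * !![(0 : ℂ), 0, 1; 0, 1, 0; 1, 0, 0] = !![(0 : ℂ), 0, 1; 0, 1, 0; 1, 0, 0] * j i a)
    (hjι : ∀ (m : Mv) (i : I), ∃ u β : ℂ, j i (ι m) = Matrix.diagonal ![u, β, u])
    (hjM : ∀ u β : I → ℂ, (∀ i, ‖u i‖ = 1) → (∀ i, ‖β i‖ = 1) → ∃ m : Mv, ∀ i, j i (ι m) = Matrix.diagonal ![u i, β i, u i])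
    (σ : Kv → Kv) (hσj : ∀ a i, j i (σ a) = (j i a)ᵀ)
    (π : ContRepresentation ℂ Kv X) (hπ : π.IsStronglyContinuous) (hU : π.IsUnitary) (hirr : π.IsTopIrreducible)
    {W : Type*} [NormedAddCommGroup W] [InnerProductSpace ℂ W] [FiniteDimensional ℂ W] (τ : ContRepresentation ℂ Mv W)
    (hτu : ∀ (m : Mv) (v w : W), ⟪τ m v, τ m w⟫_ℂ = ⟪v, w⟫_ℂ) [τ.toRepresentation.IsIrreducible] :
    ∃ S₀ : HomSpace τ (π.restrict ι), ∀ S : HomSpace τ (π.restrict ι), ∃ c : ℂ, S = c • S₀ :=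
  exists_forall_homSpace_eq_smul_of_commute_orbitalOp hirr
    (commute_orbitalOp_torus_of_transpose_realisation_pi μ ι hι hιi j hjmul hju hj hjJ hjι hjM σ hσj π hπ hU) hτu

end GelfandPairPi

/-! ## §2 HEADS: the Gelfand pair `(K_∞ × M_∞, ΔM_∞)` — commuting orbital operators and the multiplicity-≤-1 LINE for every `K_∞`-type -/

section Heads

variable (L : Type) [Field L] [NumberField L] [IsCMField L]

/-- **THE `M_∞`-ORBITAL OPERATORS OF A UNITARY `K_∞`-REPRESENTATION COMMUTE** (§1 `commute_orbitalOp_torus_of_transpose_realisation_pi` at the place-wise realisation of FILE A `R90S8ArchMaximalCompactPlacewiseU3`, for any two-sided,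
inversion-invariant probability measure on `M_∞`; the `MeasurableSpace`∕`BorelSpace`∕`CompactSpace` structure on `M_∞` is the caller's — e.g. `isCompact_archMaximalCompact_inf_borelAdelic`).
[cite: Helgason2000, Ch. IV §3 Thm. 3.1] [cite: DeitmarEchterhoff2014, Lemma 7.3.1] -/
theorem commute_orbitalOp_archTorus
    [MeasurableSpace ↥(archMaximalCompact L ⊓ borelAdelic (↥(maximalRealSubfield L)) L (IsCMField.complexConj L) 3)]
    [BorelSpace ↥(archMaximalCompact L ⊓ borelAdelic (↥(maximalRealSubfield L)) L (IsCMField.complexConj L) 3)]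
    [CompactSpace ↥(archMaximalCompact L ⊓ borelAdelic (↥(maximalRealSubfield L)) L (IsCMField.complexConj L) 3)]
    (μ : Measure ↥(archMaximalCompact L ⊓ borelAdelic (↥(maximalRealSubfield L)) L (IsCMField.complexConj L) 3)) [IsProbabilityMeasure μ] [μ.IsMulLeftInvariant]
    [μ.IsMulRightInvariant] [μ.IsInvInvariant]
    {X : Type*} [NormedAddCommGroup X] [InnerProductSpace ℂ X] [CompleteSpace X]
    (π : ContRepresentation ℂ ↥(archMaximalCompact L) X) (hπ : π.IsStronglyContinuous) (hU : π.IsUnitary) (x y : ↥(archMaximalCompact L)) :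
    Commute (orbitalOp μ (Subgroup.inclusion (inf_le_left : archMaximalCompact L ⊓ borelAdelic (↥(maximalRealSubfield L)) L (IsCMField.complexConj L) 3 ≤ archMaximalCompact L)) π
        (continuous_induced_rng.2 continuous_subtype_val) hπ hU x)
      (orbitalOp μ (Subgroup.inclusion (inf_le_left : archMaximalCompact L ⊓ borelAdelic (↥(maximalRealSubfield L)) L (IsCMField.complexConj L) 3 ≤ archMaximalCompact L)) π
        (continuous_induced_rng.2 continuous_subtype_val) hπ hU y) := by
  haveI : SecondCountableTopology (quasiSplit (↥(maximalRealSubfield L)) L (IsCMField.complexConj L) 3).Adelic :=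
    inferInstanceAs (SecondCountableTopology (adelic (↥(maximalRealSubfield L)) L (IsCMField.complexConj L) 3 ((StdForm.antidiagonal 3).over L)))
  haveI : SecondCountableTopology ↥(archMaximalCompact L ⊓ borelAdelic (↥(maximalRealSubfield L)) L (IsCMField.complexConj L) 3) :=
    Topology.IsEmbedding.subtypeVal.secondCountableTopology
  choose σ hσ using exists_mem_forall_evalC_map_eq_transpose L
  refine commute_orbitalOp_torus_of_transpose_realisation_pi μ _ _ (Subgroup.inclusion_injective _)
    (fun (w : {w : InfinitePlace L // w.IsComplex}) (k : ↥(archMaximalCompact L)) =>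
      (((archPart (↥(maximalRealSubfield L)) L (IsCMField.complexConj L) 3 ((StdForm.antidiagonal 3).over L)
          (k : (quasiSplit (↥(maximalRealSubfield L)) L (IsCMField.complexConj L) 3).Adelic) :
          arch (↥(maximalRealSubfield L)) L (IsCMField.complexConj L) 3 ((StdForm.antidiagonal 3).over L)) : GL (Fin 3) (mixedEmbedding.mixedSpace L)) :
          Matrix (Fin 3) (Fin 3) (mixedEmbedding.mixedSpace L)).map (evalC L w))
    (fun w a b => by simp only [Subgroup.coe_mul, map_mul, Units.val_mul, Matrix.map_mul])
    (fun w k => evalC_map_mem_unitaryGroup L _ (adelicVal_archToAdelic_archPart_mem L k.2.1) w)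
    (eq_of_forall_evalC_map_archPart_eq L)
    (fun w k => evalC_map_mul_antidiagonal_eq' L _ (adelicVal_archToAdelic_archPart_mem L k.2.1) w)
    (fun m w => ?_) (fun u β hu hβ => ?_) σ hσ π hπ hU x y
  · obtain ⟨u, β, -, -, h⟩ := exists_evalC_map_eq_diagonal L
      (archPart (↥(maximalRealSubfield L)) L (IsCMField.complexConj L) 3 ((StdForm.antidiagonal 3).over L)
        (m : (quasiSplit (↥(maximalRealSubfield L)) L (IsCMField.complexConj L) 3).Adelic))
      (adelicVal_archToAdelic_archPart_mem L m.2.1.1) (by rw [archToAdelic_archPart_of_mem L m.2.1]; exact m.2.2) w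
    exact ⟨u, β, h⟩
  · obtain ⟨m, hm, h⟩ := exists_mem_inf_forall_evalC_map_eq_diagonal L u β hu hβ
    exact ⟨⟨m, hm⟩, h⟩

/-- **HEAD — MULTIPLICITY ONE OF `M_∞`-TYPES IN `K_∞`-TYPES (★ (α) AT THE ARCHIMEDEAN MAXIMAL COMPACT OF RECORD), μ-FREE and `MeasurableSpace`-FREE**: for `π` an irreducible unitary strongly
continuous representation of `K_∞ = ↥(archMaximalCompact L)` on a Hilbert space and `τ` a finite-dimensional irreducible unitary representation of the torus `M_∞ = ↥(archMaximalCompact L ⊓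
borelAdelic L⁺ L c 3)` (every unitary character, e.g. `m ↦ χ₁(m₀₀)χ₂(m₁₁)`), the multiplicity space `Hom_{M_∞}(τ, π|_{M_∞})` along `ι := Subgroup.inclusion inf_le_left` is AT MOST A LINE:
`∃ S₀, ∀ S, ∃ c, S = c • S₀`.  Inside: `M_∞` is compact (FILE A), Borel-ised, and carries the probability Haar measure `haarMeasure ⊤`, two-sided and inversion invariant (★ `HaarLocalChart`); then
`commute_orbitalOp_archTorus` and ★ `exists_forall_homSpace_eq_smul_of_commute_orbitalOp`. [cite: Helgason2000, Ch. IV §3 Thm. 3.1] [cite: Knapp1986, VIII §3] [cite: DeitmarEchterhoff2014, Lemma 7.3.1]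
[cite: Rogawski1990, §12.3] -/
theorem exists_forall_homSpace_archTorus_eq_smul
    {X : Type*} [NormedAddCommGroup X] [InnerProductSpace ℂ X] [CompleteSpace X]
    (π : ContRepresentation ℂ ↥(archMaximalCompact L) X) (hπ : π.IsStronglyContinuous) (hU : π.IsUnitary) (hirr : π.IsTopIrreducible)
    {W : Type*} [NormedAddCommGroup W] [InnerProductSpace ℂ W] [FiniteDimensional ℂ W]
    (τ : ContRepresentation ℂ ↥(archMaximalCompact L ⊓ borelAdelic (↥(maximalRealSubfield L)) L (IsCMField.complexConj L) 3) W)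
    (hτu : ∀ (m : ↥(archMaximalCompact L ⊓ borelAdelic (↥(maximalRealSubfield L)) L (IsCMField.complexConj L) 3)) (v w : W), ⟪τ m v, τ m w⟫_ℂ = ⟪v, w⟫_ℂ)
    [τ.toRepresentation.IsIrreducible] :
    ∃ S₀ : HomSpace τ (π.restrict (Subgroup.inclusion (inf_le_left : archMaximalCompact L ⊓ borelAdelic (↥(maximalRealSubfield L)) L (IsCMField.complexConj L) 3 ≤ archMaximalCompact L))),
      ∀ S : HomSpace τ (π.restrict (Subgroup.inclusion (inf_le_left : archMaximalCompact L ⊓ borelAdelic (↥(maximalRealSubfield L)) L (IsCMField.complexConj L) 3 ≤ archMaximalCompact L))),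
        ∃ c : ℂ, S = c • S₀ := by
  haveI : CompactSpace ↥(archMaximalCompact L ⊓ borelAdelic (↥(maximalRealSubfield L)) L (IsCMField.complexConj L) 3) :=
    isCompact_iff_compactSpace.1 (isCompact_archMaximalCompact_inf_borelAdelic L)
  haveI : SecondCountableTopology (quasiSplit (↥(maximalRealSubfield L)) L (IsCMField.complexConj L) 3).Adelic :=
    inferInstanceAs (SecondCountableTopology (adelic (↥(maximalRealSubfield L)) L (IsCMField.complexConj L) 3 ((StdForm.antidiagonal 3).over L)))
  haveI : SecondCountableTopology ↥(archMaximalCompact L ⊓ borelAdelic (↥(maximalRealSubfield L)) L (IsCMField.complexConj L) 3) :=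
    Topology.IsEmbedding.subtypeVal.secondCountableTopology
  borelize ↥(archMaximalCompact L ⊓ borelAdelic (↥(maximalRealSubfield L)) L (IsCMField.complexConj L) 3)
  set μ : Measure ↥(archMaximalCompact L ⊓ borelAdelic (↥(maximalRealSubfield L)) L (IsCMField.complexConj L) 3) := haarMeasure ⊤ with hμ
  haveI : IsProbabilityMeasure μ := ⟨by rw [hμ, ← TopologicalSpace.PositiveCompacts.coe_top]; exact haarMeasure_self⟩
  haveI : μ.IsMulRightInvariant := Literature.MeasureTheory.Group.HaarLocalChart.isMulRightInvariant_of_isHaarMeasure μ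
  haveI : μ.IsInvInvariant := Literature.MeasureTheory.Group.HaarLocalChart.isInvInvariant_of_isHaarMeasure μ
  exact exists_forall_homSpace_eq_smul_of_commute_orbitalOp hirr (commute_orbitalOp_archTorus L μ π hπ hU) hτu

end Heads

end Summit.HodgeConjecture.HodgeConjecture.R90.S8

end
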